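import Summits.HubbardSuperconductivity.HubbardSuperconductivity.Theorems.AnisotropyChordSpinSectorPerron
import Literature.MathematicalPhysics.QuantumLattice.FinDimSpectrumSectorGibbsLimit
import Literature.MathematicalPhysics.QuantumLattice.XYOrderDischarges
import Literature.MathematicalPhysics.QuantumLattice.HardCoreBosonHalfFillingOptimal
import Literature.MathematicalPhysics.QuantumLattice.AndersonTowerOfStates
import Literature.Probability.LatticeModels.TorusBipartite

/-!
# Route `AnisotropyChord`, crux `ChordXY` (stmt-HubbardSuperconductivity-8146), line `thermal_af` /
# birth skeleton — registered stub `stub_groundStateLimit`, DEF-FREE FORM (proved)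

Notation: `H_M(Δ) = xxzHamiltonian 1 (torusGraph 2 M) (-1) Δ` (spin-½ XXZ torus of side `M`),
`K = spinZSector 1 0` (the half-filled sector `S^z_tot = 0`), `P_K` its orthogonal projection
(`projMatrix` of the sector transported to `EuclideanSpace`, the Literature's convention),
`A = S⁺_tot S⁻_tot`, and the finite-temperature condensate of the sector
`Λ_{β,M}(Δ) = Re( tr(P_K e^{-βH_M(Δ)} A) / tr(P_K e^{-βH_M(Δ)}) )` (`e^{-βH} = Matrix.gibbsWeight β H`).

* `projMatrix_map_eq_vecMulVec_of_unique` — the orthogonal projection onto a subspace spanned by ONE unit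
  vector `ψ` is `|ψ⟩⟨ψ|` (`vecMulVec ψ (star ψ)`);
* `xxzTorus_sectorGroundSpace_unique` — Perron–Frobenius (tree theorem
  `xxzSpin_sector_perron_of_connected`, Tasaki 2020 §2.2/§4.1): for EVERY real `Δ` the `S^z_tot = 0`
  sector ground eigenspace `K ⊓ ker(H_M(Δ) − e₀)` of the XXZ torus (`M ≥ 2`) is the line through any of
  its normalised sector ground states `ψ`;
* `tendsto_thermalCondensate_groundState` — **the stub, defs unfolded**: for every normalised sector
  ground state `ψ` of `H_M(Δ)`, `Λ_{β,M}(Δ) ⟶ Re⟨ψ, S⁺_tot S⁻_tot ψ⟩` as `β → ∞`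
  (`tendsto_sectorGibbsAverage_atTop` gives the limit `tr(P_{E₀}A)/tr P_{E₀}` on the sector ground
  eigenspace `E₀`, and `E₀ = ℂψ` identifies it).

The registered stub `stub_groundStateLimit` of the skeleton (`Cruxes/ChordFM/Lines/thermal_af.lean`, and
verbatim the `ChordXY` birth skeleton) is this theorem after `unfold thermalCondensate sectorProj
condensateOp`. Sources: H. Tasaki, *Physics and Mathematics of Quantum Many-Body Systems* (2020) §2.2,
App. A.2; O. Bratteli, D. W. Robinson, *Operator Algebras and Quantum Statistical Mechanics II* §5.3.1
(ground states as zero-temperature limits of Gibbs states). Folklore; no definition is introduced.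
-/

set_option linter.dupNamespace false

noncomputable section

namespace Summit.HubbardSuperconductivity.HubbardSuperconductivity.Theorems.AnisotropyChord

open Matrix Filter Topology
open Literature.MathematicalPhysics.QuantumLattice Literature.Probability.LatticeModels

section RankOne

variable {n : Type*} [Fintype n] [DecidableEq n]

/-- **The projection onto a line is `|ψ⟩⟨ψ|`.** If `ψ ∈ K` is a unit vector and every vector of `K` is a
multiple of `ψ`, then the orthogonal projection onto (the transport to `EuclideanSpace` of) `K` is
`vecMulVec ψ (star ψ)`. Tasaki (2020) App. A.2. [folklore] -/
theorem projMatrix_map_eq_vecMulVec_of_unique (K : Submodule ℂ (n → ℂ)) {ψ : n → ℂ} (hψK : ψ ∈ K)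
    (hψ1 : star ψ ⬝ᵥ ψ = 1) (huniq : ∀ v ∈ K, ∃ c : ℂ, v = c • ψ) :
    projMatrix (K.map ((WithLp.linearEquiv 2 ℂ (n → ℂ)).symm : (n → ℂ) →ₗ[ℂ] EuclideanSpace ℂ n)) =
      vecMulVec ψ (star ψ) := by
  rw [ext_iff_mulVec]
  intro v
  -- `v = ⟨ψ,v⟩ψ + w` with `w ⊥ K`
  have hw : ∀ u ∈ K, star u ⬝ᵥ (v - (star ψ ⬝ᵥ v) • ψ) = 0 := by
    intro u hu
    obtain ⟨c, rfl⟩ := huniq u hu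
    rw [star_smul, smul_dotProduct, dotProduct_sub, dotProduct_smul, hψ1]
    simp
  have h1 : projMatrix (K.map ((WithLp.linearEquiv 2 ℂ (n → ℂ)).symm :
        (n → ℂ) →ₗ[ℂ] EuclideanSpace ℂ n)) *ᵥ v =
      projMatrix (K.map ((WithLp.linearEquiv 2 ℂ (n → ℂ)).symm :
          (n → ℂ) →ₗ[ℂ] EuclideanSpace ℂ n)) *ᵥ ((star ψ ⬝ᵥ v) • ψ) +
        projMatrix (K.map ((WithLp.linearEquiv 2 ℂ (n → ℂ)).symm :
          (n → ℂ) →ₗ[ℂ] EuclideanSpace ℂ n)) *ᵥ (v - (star ψ ⬝ᵥ v) • ψ) := by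
    rw [← mulVec_add, add_sub_cancel]
  rw [h1, projMatrix_map_mulVec_eq_zero_of_orthogonal K hw, add_zero, mulVec_smul,
    projMatrix_map_mulVec_of_mem K hψK, vecMulVec_mulVec, op_smul_eq_smul]

end RankOne

/-- **The `S^z_tot = 0` sector ground eigenspace of the XXZ torus is a line** (every real `Δ`, side
`M ≥ 2`): if `ψ` is a normalised sector ground state of `H_M(Δ)`, every vector of
`spinZSector 1 0 ⊓ ker(H_M(Δ) − e₀)` (`e₀` the sector energy) is a multiple of `ψ` — sector
Perron–Frobenius (`xxzSpin_sector_perron_of_connected`; the torus graph is connected). Tasaki (2020)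
§2.2, §4.1. [folklore] -/
theorem xxzTorus_sectorGroundSpace_unique (M : ℕ) [NeZero M] (h2 : 2 ≤ M) (Δ : ℝ)
    {ψ : TensorIndex (TorusSite 2 M) 2 → ℂ} (hmem : ψ ∈ spinZSector (Λ := TorusSite 2 M) 1 0)
    (hψ1 : star ψ ⬝ᵥ ψ = 1)
    (heig : xxzHamiltonian 1 (torusGraph 2 M) (-1) Δ *ᵥ ψ =
      ((lowestEnergyInSector 1 (xxzHamiltonian 1 (torusGraph 2 M) (-1) Δ) 0 : ℝ) : ℂ) • ψ) :
    ∀ v ∈ spinZSector (Λ := TorusSite 2 M) 1 0 ⊓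
        Module.End.eigenspace (Matrix.toLin' (xxzHamiltonian 1 (torusGraph 2 M) (-1) Δ))
          (((xxzHamiltonian 1 (torusGraph 2 M) (-1) Δ).minEnergyOn
            (spinZSector (Λ := TorusSite 2 M) 1 0) : ℝ) : ℂ),
      ∃ c : ℂ, v = c • ψ := by
  intro v hv
  have hψ0 : ψ ≠ 0 := by
    intro h
    rw [h, dotProduct_zero] at hψ1
    exact zero_ne_one hψ1
  have hK : spinZSector (Λ := TorusSite 2 M) 1 0 ≠ ⊥ := by
    intro h
    rw [h, Submodule.mem_bot] at hmem
    exact hψ0 hmem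
  haveI : Fact (1 < M) := ⟨h2⟩
  haveI : Nontrivial (TorusSite 2 M) := Pi.nontrivial
  obtain ⟨χ₀, -, -, -, -, huniq⟩ :=
    xxzSpin_sector_perron_of_connected 1 one_pos (torusGraph 2 M) (torusGraph_connected_of_proj 2 M) Δ hK
  obtain ⟨c₁, hc₁⟩ := huniq ψ hmem heig
  have hc₁0 : c₁ ≠ 0 := by
    rintro rfl
    rw [zero_smul] at hc₁
    exact hψ0 hc₁
  have hvK : v ∈ spinZSector (Λ := TorusSite 2 M) 1 0 := (Submodule.mem_inf.mp hv).1
  have hveig : xxzHamiltonian 1 (torusGraph 2 M) (-1) Δ *ᵥ v =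
      ((lowestEnergyInSector 1 (xxzHamiltonian 1 (torusGraph 2 M) (-1) Δ) 0 : ℝ) : ℂ) • v := by
    have h := Module.End.mem_eigenspace_iff.mp (Submodule.mem_inf.mp hv).2
    rw [Matrix.toLin'_apply] at h
    exact h
  obtain ⟨c, hc⟩ := huniq v hvK hveig
  refine ⟨c * c₁⁻¹, ?_⟩
  rw [hc, mul_smul, hc₁, smul_smul c₁⁻¹, inv_mul_cancel₀ hc₁0, one_smul]

/-- **Registered stub `stub_groundStateLimit`, defs unfolded — the ground-state limit of the canonical
sector condensate.** For `M ≥ 2`, every real `Δ` and every normalised `S^z_tot = 0` sector ground state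
`ψ` of `H_M(Δ) = xxzHamiltonian 1 (torusGraph 2 M) (-1) Δ`,
`Re( tr(P_K e^{-βH_M(Δ)} S⁺_tot S⁻_tot) / tr(P_K e^{-βH_M(Δ)}) ) ⟶ Re⟨ψ, S⁺_tot S⁻_tot ψ⟩` as `β → ∞`:
the zero-temperature limit of the sector Gibbs state (`tendsto_sectorGibbsAverage_atTop`) is the average
over the sector ground eigenspace, which is the line `ℂψ` (`xxzTorus_sectorGroundSpace_unique`), whose
projection is `|ψ⟩⟨ψ|`. (The hypothesis `Even M` of the registered signature is not used.)
Tasaki (2020) §2.2, App. A.2; Bratteli–Robinson II §5.3.1. [folklore] -/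
theorem tendsto_thermalCondensate_groundState :
    ∀ (M : ℕ) [NeZero M], Even M → 2 ≤ M → ∀ (Δ : ℝ)
      (ψ : TensorIndex (TorusSite 2 M) 2 → ℂ), ψ ∈ spinZSector (Λ := TorusSite 2 M) 1 0 →
        star ψ ⬝ᵥ ψ = 1 →
        Matrix.mulVec (xxzHamiltonian 1 (torusGraph 2 M) (-1) Δ) ψ =
          ((lowestEnergyInSector 1 (xxzHamiltonian 1 (torusGraph 2 M) (-1) Δ) 0 : ℝ) : ℂ) • ψ →
        Tendsto (fun β : ℝ =>
          ((projMatrix ((spinZSector (Λ := TorusSite 2 M) 1 0).map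
              ((WithLp.linearEquiv 2 ℂ (TensorIndex (TorusSite 2 M) 2 → ℂ)).symm :
                (TensorIndex (TorusSite 2 M) 2 → ℂ) →ₗ[ℂ]
                  EuclideanSpace ℂ (TensorIndex (TorusSite 2 M) 2))) *
              gibbsWeight β (xxzHamiltonian 1 (torusGraph 2 M) (-1) Δ) *
              ((∑ x : TorusSite 2 M, onSite x (spinRaise 1)) *
                (∑ y : TorusSite 2 M, onSite y (spinLower 1)))).trace /
            (projMatrix ((spinZSector (Λ := TorusSite 2 M) 1 0).map
              ((WithLp.linearEquiv 2 ℂ (TensorIndex (TorusSite 2 M) 2 → ℂ)).symm :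
                (TensorIndex (TorusSite 2 M) 2 → ℂ) →ₗ[ℂ]
                  EuclideanSpace ℂ (TensorIndex (TorusSite 2 M) 2))) *
              gibbsWeight β (xxzHamiltonian 1 (torusGraph 2 M) (-1) Δ)).trace).re) atTop
          (𝓝 ((star ψ ⬝ᵥ Matrix.mulVec ((∑ x : TorusSite 2 M, onSite x (spinRaise 1)) *
            (∑ y : TorusSite 2 M, onSite y (spinLower 1))) ψ).re)) := by
  intro M _ _ h2 Δ ψ hmem hψ1 heig
  set H : Matrix (TensorIndex (TorusSite 2 M) 2) (TensorIndex (TorusSite 2 M) 2) ℂ :=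
    xxzHamiltonian 1 (torusGraph 2 M) (-1) Δ with hH
  set K : Submodule ℂ (TensorIndex (TorusSite 2 M) 2 → ℂ) := spinZSector (Λ := TorusSite 2 M) 1 0
    with hK
  set A : Matrix (TensorIndex (TorusSite 2 M) 2) (TensorIndex (TorusSite 2 M) 2) ℂ :=
    (∑ x : TorusSite 2 M, onSite x (spinRaise 1)) * (∑ y : TorusSite 2 M, onSite y (spinLower 1))
    with hA
  have hHh : H.IsHermitian := xxzHamiltonian_isHermitian 1 (torusGraph 2 M) (-1) Δ
  have hinv : ∀ v ∈ K, H *ᵥ v ∈ K := fun v hv =>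
    XXZKT.mulVec_mem_spinZSector_of_commute
      (HardCoreBoson.commute_xxzHamiltonian_totalSpin_two 1 (torusGraph 2 M) (-1) Δ) hv
  -- the sector ground eigenspace `E₀ = K ⊓ ker(H − e₀)` contains `ψ` and is the line `ℂψ`
  set E₀ : Submodule ℂ (TensorIndex (TorusSite 2 M) 2 → ℂ) :=
    K ⊓ Module.End.eigenspace (Matrix.toLin' H) ((H.minEnergyOn K : ℝ) : ℂ) with hE₀
  have hψE₀ : ψ ∈ E₀ := by
    refine Submodule.mem_inf.mpr ⟨hmem, Module.End.mem_eigenspace_iff.mpr ?_⟩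
    rw [Matrix.toLin'_apply]
    exact heig
  have hψ0 : ψ ≠ 0 := by
    intro h
    rw [h, dotProduct_zero] at hψ1
    exact zero_ne_one hψ1
  have hE₀ne : E₀ ≠ ⊥ := by
    intro h
    rw [h, Submodule.mem_bot] at hψE₀
    exact hψ0 hψE₀
  have huniq : ∀ v ∈ E₀, ∃ c : ℂ, v = c • ψ :=
    xxzTorus_sectorGroundSpace_unique M h2 Δ hmem hψ1 heig
  have hP₀ := projMatrix_map_eq_vecMulVec_of_unique E₀ hψE₀ hψ1 huniq
  -- the zero-temperature limit of the sector Gibbs average, with `P_{E₀} = |ψ⟩⟨ψ|`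
  have hlim := tendsto_sectorGibbsAverage_atTop hHh K hinv hE₀ne A
  have htr1 : (vecMulVec ψ (star ψ) * A).trace = star ψ ⬝ᵥ A *ᵥ ψ := by
    rw [vecMulVec_mul, trace_vecMulVec, dotProduct_comm, dotProduct_mulVec]
  have htr2 : (vecMulVec ψ (star ψ)).trace = 1 := by rw [trace_vecMulVec, dotProduct_comm, hψ1]
  rw [← hE₀, hP₀, htr1, htr2, div_one] at hlim
  exact (Complex.continuous_re.tendsto _).comp hlim

end Summit.HubbardSuperconductivity.HubbardSuperconductivity.Theorems.AnisotropyChord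

end
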